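import Mathlib
import Summits.Ventures.HodgeRepro2.Tier7.Line3.KappaDataOfAdaptedRep
import Summits.Ventures.HodgeRepro2.Tier7.Line3.KappaDataFinLocal

/-!
# Tier7/Line3/FinKappaOfLocal — the κ-level finite data `FinKappa` FROM THE LOCAL ADAPTED COORDINATES at every finite
place (seat t7-x1, gen 2; the per-datum bridge of crit-2's record R3 (l. 15517) on L1-p5's `KappaDataFinLocal` p685687)

`KappaDataOfAdaptedRep` (p685088) takes the finite side of the residual at the κ-LEVEL (`FinKappa`: `hcong / hS / hout`
on `|κF γ − κF γ₀|_w`, torus-invariant). L1-p5's `KappaDataFinLocal` derives each of those clauses at a non-split place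
`w` from the ADELIC support condition read in the completion `E_w`: «on the support SOME local torus translate of
`ψ_w(matO γ)` is integral / of size `≤ M` / equals `γ₀_w · k` with `k ≡ 1 mod q⁻¹^N`» (`IsTranslate`; p1's
`kappa_diag_mul` over `E_w`). This module packages the local data of ALL finite places — a completion `Ew w` with its
involution `σw w`, the embedding `ψ w : E →+* Ew w`, the absolute value `abv w` above `w`, and the local support clauses
(integrality off `S`, entry bounds `M w` at `S`, the level-`N` congruence at `v₁`) — into **`LocalFin`** (the completions
`Ew w` are parameters with their field structure; no instance is declared) and builds
**`LocalFin.toFinKappa : FinKappa κF arith γ₀`** from L1-p5's three field forms. Hence, with `ArchData`,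
`ArchData.kappaDataRep A L.toFinKappa` reads the whole residual at the level of the adapted coordinates: archimedean
side at the pinned representing pairs, finite side at the local torus translates. The clauses are the NON-SPLIT shape
(`E ⊗ K_w = E_w` a field: `hσ : abv_w ∘ σ_w = abv_w`); at a place split in `E/K` the local algebra is `K_w × K_w` and
the clause is to be displayed at the κ-level (L1-p5 l. 15525: «split w stays with (ii)») — `LocalFin` therefore takes a
finite set `Sp` of split places with their κ-level clauses displayed, and the local shape elsewhere.
NOTHING here proves any clause for the real objects (TYPING-CENSUS T7); nothing about (N) or HC_CM; §8(d): NO.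
Blind lane: Mathlib + the HodgeRepro2 prefix only; no sorry; axioms ⊆ {propext, Classical.choice, Quot.sound}.
-/

namespace Summit.Ventures.HodgeRepro2.Tier7.Line3.KappaDataOfAdapted

open NumberField Matrix Summit.Ventures.HodgeRepro2.T7SupportTwoTorusInvariant
  Summit.Ventures.HodgeRepro2.Tier7.Line3.KappaDataFinLocal

/-- **THE LOCAL FINITE DATA**: at every finite place `w` of `K` a completion-type `Ew w` (a parameter) with involution, the embedding
of `E`, the absolute value above `w`; the places `v₁` (level), `S` (bounded denominators) and `Sp` (split in `E/K`);
at the non-split places the support clauses on LOCAL TORUS TRANSLATES of `ψ_w(matO γ)` (L1-p5's `IsTranslate`); at the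
split places the κ-level clauses displayed. -/
structure LocalFin {E K Orb : Type} [Field E] [Field K] [NumberField K] [Algebra K E]
    (Ew : FinitePlace K → Type) [∀ w, Field (Ew w)] (σ : E →+* E)
    (d : Fin 2 → E) (f : Fin 2 → Fin 2 → E) (matO : Orb → Matrix (Fin 2) (Fin 2) E) (κF : Orb → K)
    (arith : ℕ → Orb → Prop) (γ₀ : Orb) where
  /-- the descent identity -/
  hκF : ∀ γ, algebraMap K E (κF γ) = kappa σ d f (matO γ)
  /-- the place where the level shrinks -/
  v₁ : FinitePlace K
  /-- the finite places with bounded denominators -/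
  S : Finset (FinitePlace K)
  hv₁S : v₁ ∉ S
  /-- the finite places split in `E / K` (their clauses displayed at the κ-level); `v₁` is not split -/
  Sp : Finset (FinitePlace K)
  hv₁Sp : v₁ ∉ Sp
  /-- the residue-size parameter at `v₁` -/
  q : ℝ
  hq : 1 < q
  /-- the local involution of the completion `Ew w` -/
  σw : ∀ w, Ew w →+* Ew w
  /-- the embedding of `E` into the completion -/
  ψ : ∀ w, E →+* Ew w
  /-- the absolute value of the completion above `w` -/
  abv : ∀ w, AbsoluteValue (Ew w) ℝ
  hψ : ∀ w x, ψ w (σ x) = σw w (ψ w x)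
  habv : ∀ (w : FinitePlace K) (x : K), w x = abv w (ψ w (algebraMap K E x))
  hna : ∀ w, IsNonarchimedean (abv w)
  hσ : ∀ w x, abv w (σw w x) = abv w x
  /-- integrality of the local adapted data at the places off `S` -/
  hf_int : ∀ w, w ∉ S → ∀ i, abv w (ψ w (f 0 i)) ≤ 1
  hd_int : ∀ w, w ∉ S → abv w (ψ w (d 0)) ≤ 1
  hdisc_unit : ∀ w, w ∉ S →
    abv w (ψ w (d 0) * disc' (σw w) (fun i => ψ w (d i)) (fun j i => ψ w (f j i)) 0) = 1
  /-- some local torus translate of `γ₀` is integral at the non-split places off `S` -/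
  hγ₀_int : ∀ w, w ∉ S → w ∉ Sp → ∃ m₀, IsTranslate (σw w) (fun j i => ψ w (f j i)) ((matO γ₀).map (ψ w)) m₀ ∧
    ∀ i j, abv w (m₀ i j) ≤ 1
  /-- on the support, some local torus translate is integral at the non-split places off `S ∪ {v₁}` -/
  hsupp_int : ∀ w, w ∉ S → w ∉ Sp → w ≠ v₁ → ∀ N γ, arith N γ →
    ∃ m, IsTranslate (σw w) (fun j i => ψ w (f j i)) ((matO γ).map (ψ w)) m ∧ ∀ i j, abv w (m i j) ≤ 1
  /-- the entry bounds at the non-split places of `S` -/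
  M : FinitePlace K → ℝ
  hM : ∀ w ∈ S, 0 < M w
  hf_S : ∀ w ∈ S, ∀ i, abv w (ψ w (f 0 i)) ≤ M w
  hd_S : ∀ w ∈ S, abv w (ψ w (d 0)) ≤ M w
  hγ₀_S : ∀ w ∈ S, w ∉ Sp → ∃ m₀, IsTranslate (σw w) (fun j i => ψ w (f j i)) ((matO γ₀).map (ψ w)) m₀ ∧
    ∀ i j, abv w (m₀ i j) ≤ M w
  hsupp_S : ∀ w ∈ S, w ∉ Sp → ∀ N γ, arith N γ →
    ∃ m, IsTranslate (σw w) (fun j i => ψ w (f j i)) ((matO γ).map (ψ w)) m ∧ ∀ i j, abv w (m i j) ≤ M w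
  hdisc_S : ∀ w ∈ S, abv w (ψ w (d 0) * disc' (σw w) (fun i => ψ w (d i)) (fun j i => ψ w (f j i)) 0) ≠ 0
  /-- the level-`N` congruence at `v₁`: a local translate of `γ₀`, integral, and on the support a local translate equal
  to `γ₀_w · k` with `k ≡ 1 mod q⁻¹ ^ N` -/
  γ₀w : Matrix (Fin 2) (Fin 2) (Ew v₁)
  hγ₀w : IsTranslate (σw v₁) (fun j i => ψ v₁ (f j i)) ((matO γ₀).map (ψ v₁)) γ₀w
  hγ₀w_int : ∀ i j, abv v₁ (γ₀w i j) ≤ 1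
  hsupp_cong : ∀ N γ, arith N γ → ∃ k : Matrix (Fin 2) (Fin 2) (Ew v₁),
    IsTranslate (σw v₁) (fun j i => ψ v₁ (f j i)) ((matO γ).map (ψ v₁)) (γ₀w * k) ∧
      ∀ i j, abv v₁ ((k - 1) i j) ≤ q⁻¹ ^ N
  /-- the κ-level clauses at the split places (displayed): the bound at `S ∩ Sp`, integrality at `Sp ∖ S` -/
  hS_split : ∀ N γ, arith N γ → ∀ w ∈ S, w ∈ Sp → w (κF γ - κF γ₀) ≤ M w ^ 6
  hout_split : ∀ N γ, arith N γ → ∀ w ∈ Sp, w ∉ S → w (κF γ - κF γ₀) ≤ 1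

namespace LocalFin

variable {E K Orb : Type} [Field E] [Field K] [NumberField K] [Algebra K E] {Ew : FinitePlace K → Type}
  [∀ w, Field (Ew w)] {σ : E →+* E}
  {d : Fin 2 → E} {f : Fin 2 → Fin 2 → E} {matO : Orb → Matrix (Fin 2) (Fin 2) E} {κF : Orb → K}
  {arith : ℕ → Orb → Prop} {γ₀ : Orb} (L : LocalFin Ew σ d f matO κF arith γ₀)

open scoped Classical in
/-- the denominator bound at a place of `S`: `M w ^ 6 / |d₀ d′₀|_w` at a non-split place (L1-p5's `hS_field_local`),
`M w ^ 6` at a split place (displayed) -/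
noncomputable def B (w : FinitePlace K) : ℝ :=
  if w ∈ L.Sp then L.M w ^ 6
  else L.M w ^ 6 / L.abv w (L.ψ w (d 0) * disc' (L.σw w) (fun i => L.ψ w (d i)) (fun j i => L.ψ w (f j i)) 0)

open scoped Classical in
/-- the denominator bounds are positive -/
theorem B_pos (w : FinitePlace K) (hw : w ∈ L.S) : 0 < L.B w := by
  unfold B
  split_ifs with hsp
  · exact pow_pos (L.hM w hw) 6
  · exact div_pos (pow_pos (L.hM w hw) 6) (lt_of_le_of_ne ((L.abv w).nonneg _) (Ne.symm (L.hdisc_S w hw)))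

open scoped Classical in
/-- **`FinKappa` FROM THE LOCAL DATA**: the three κ-level clauses from the local torus translates at every non-split place
(L1-p5's `hcong_field_local` / `hS_field_local` / `hout_field_local`) and from the displayed clauses at the split places. -/
noncomputable def toFinKappa : FinKappa κF arith γ₀ where
  v₁ := L.v₁
  S := L.S
  hv₁S := L.hv₁S
  q := L.q
  hq := L.hq
  B := L.B
  hBpos := L.B_pos
  hcong := hcong_field_local σ (L.σw L.v₁) (L.ψ L.v₁) (L.abv L.v₁) d f matO κF L.v₁ arith γ₀ (L.hψ L.v₁)
    (L.habv L.v₁) L.hκF (L.hna L.v₁) (L.hσ L.v₁) (L.hf_int L.v₁ L.hv₁S) (L.hd_int L.v₁ L.hv₁S)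
    (L.hdisc_unit L.v₁ L.hv₁S) L.hq L.γ₀w L.hγ₀w L.hγ₀w_int L.hsupp_cong
  hS := fun N γ hγ w hw => by
    unfold B
    split_ifs with hsp
    · exact L.hS_split N γ hγ w hw hsp
    · exact hS_field_local σ (L.σw w) (L.ψ w) (L.abv w) d f matO κF w arith γ₀ (L.hψ w) (L.habv w) L.hκF
        (L.hna w) (L.hσ w) (L.hM w hw).le (L.hf_S w hw) (L.hd_S w hw) (L.hγ₀_S w hw hsp) (L.hsupp_S w hw hsp) N γ hγ
  hout := fun N γ hγ w hwS hwv => by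
    by_cases hsp : w ∈ L.Sp
    · exact L.hout_split N γ hγ w hsp hwS
    · exact hout_field_local σ (L.σw w) (L.ψ w) (L.abv w) d f matO κF w arith γ₀ (L.hψ w) (L.habv w) L.hκF
        (L.hna w) (L.hσ w) (L.hf_int w hwS) (L.hd_int w hwS) (L.hdisc_unit w hwS) (L.hγ₀_int w hwS hsp)
        (L.hsupp_int w hwS hsp hwv) N γ hγ

end LocalFin

end Summit.Ventures.HodgeRepro2.Tier7.Line3.KappaDataOfAdapted
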